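import Summits.CriticalPhenomena.CardyFormulaZ2.Theorems.CardyMagicRigidityPinchResamplingDefsV4
import Summits.CriticalPhenomena.CardyFormulaZ2.Theorems.CardyMagicRigidityNestingRigidityTomographyAssembly
import Summits.CriticalPhenomena.CardyFormulaZ2.Theorems.CardyMagicRigidityNestingRigidityBlobGraph
import Summits.CriticalPhenomena.CardyFormulaZ2.Theorems.CardyMagicRigidityNestingRigidityNeckCoarseStructure
import Summits.CriticalPhenomena.CardyFormulaZ2.Theorems.CardyMagicRigidityNestingRigidityNeckCoarseReduction
import Summits.CriticalPhenomena.CardyFormulaZ2.Theorems.CardyMagicRigidityNestingRigidityNeckCoarseZ2Locality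
import Summits.CriticalPhenomena.CardyFormulaZ2.Theorems.CardyMagicRigidityNestingRigidityNeckCoarseZ2Reduction
import Summits.CriticalPhenomena.CardyFormulaZ2.Theorems.CardyMagicRigidityNestingRigidityNoNeckRigidity
import Summits.CriticalPhenomena.CardyFormulaZ2.Theorems.CardyMagicRigidityNestingRigidityFiveArmUpperT
import Summits.CriticalPhenomena.CardyFormulaZ2.Theorems.CardyMagicRigidityNestingRigidityFiveArmUpperZ2
import Summits.CriticalPhenomena.CardyFormulaZ2.Theorems.CardyMagicRigidityNestingRigidityCouplingPlumbing
import Summits.CriticalPhenomena.CardyFormulaZ2.Theorems.CardyMagicRigidityNestingRigidityBlindCouplings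
import Summits.CriticalPhenomena.CardyFormulaZ2.Theorems.CardyMagicRigidityNestingRigidityRecoupling
import Summits.CriticalPhenomena.CardyFormulaZ2.Theorems.CardyMagicRigidityNestingRigidityRoutingOdds
import Summits.CriticalPhenomena.CardyFormulaZ2.Theorems.CardyMagicRigidityNestingRigidityBlindBigLoops
import Summits.CriticalPhenomena.CardyFormulaZ2.Theorems.CardyMagicRigidityNestingRigidityLoopGluing
import Summits.CriticalPhenomena.CardyFormulaZ2.Theorems.CardyMagicRigidityNestingRigidityGoodEventCounting
import Summits.CriticalPhenomena.CardyFormulaZ2.Theorems.CardyMagicRigidityNestingRigiditySwitchParity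
import Summits.CriticalPhenomena.CardyFormulaZ2.Theorems.CardyMagicRigidityNestingRigidityExteriorConditioning
import Summits.CriticalPhenomena.CardyFormulaZ2.Theorems.CardyMagicRigidityNestingRigiditySixArmZ2OfFiveArm
import Summits.CriticalPhenomena.CardyFormulaZ2.Theorems.CardyMagicRigidityNestingRigidityTameRigidityWitness
import Summits.CriticalPhenomena.CardyFormulaZ2.Theorems.CardyMagicRigidityNestingRigidityTameRigidityLaws
import Summits.CriticalPhenomena.CardyFormulaZ2.Theorems.CardyMagicRigidityNestingRigidityRegularNotRigid
import Literature.Barriers.CriticalPhenomena.NestingTransformBlindness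
import Literature.Probability.Percolation.FiveArmLowerBound
import Literature.Probability.Percolation.ZdFourArmFromFiveArm
import Literature.Probability.RandomPlanarGeometry.CurveMonotoneReparam
import Literature.Probability.RandomPlanarGeometry.LoopDistanceParametrisation
import HarnessLib

/-!
# Line `pinch-resampling` v4 for crux `NestingRigidity` (stmt-CriticalPhenomena-4835) — lead seat c5-0 (2026-08-17)

Crux (fixed): `NestingRigidity ≡ MagicFormulaZ2 → MagicFormulaT → LoopLimitZ2EqT` (`Iff.rfl`).  Vocabulary: `…PinchResamplingDefs`
(v2 objects, `LoopLimitZ2Blind`), `…PinchResamplingDefsV3` (`FiveArmUpperT`, `FiveArmUpperZ2`, `NeckFree`, `NoNeckRigidity`), and the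
v4 addendum `…PinchResamplingDefsV4` (p152476): `condProbOff`, `coarseBlobs`, `tHookProb`/`tCoarse`/`NeckHookupCoarseT`,
`ZFourStrands`/`ZHookR`/`zHookProb`/`zCoarse`/`NeckHookupCoarseZ2`, `NeckTomographyV4`.

HISTORY.  v2 (strategist p1): S1 blind rigidity + S2/S3 four-arm coupling property + S4 tomographic transfer — wave 1 (lead c5-0)
landed 12 reductions and the S4 mechanism audit showed S2/S3 TRUE but unconsumed ⇒ v3: S1 + S5/S6 five-arm upper bounds + S9
no-neck rigidity + S10 transfer — wave 2 CLOSED S9 (`stub_noNeckRigidity`, p151077, unconditional; bricks p150322 p150588),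
reduced S5/S6 to three Literature named facts now in the tree (p151653 `Nolin2008_thm24_fiveArm_upper`,
`Nolin2008_prop17_quasiMult`; p151214 `DuminilCopinManolescuTassion2021_zdFiveArm_upperBound`) through the landed conditional
theorems `fiveArmUpperT_of_nolin2008_facts` (p151657) and `fiveArmUpperZ2_of_DCMT2021` (p151216), and found S10 mis-cut: its
identification step consumes the COARSE MEASURABILITY of neck hook-up probabilities on each lattice ⇒ v4 cuts these out.

STUBS v4 (7; sorries ONLY inside these; `NestingRigidity_of` concludes the crux BY NAME):
* S1   `stub_blindRigidity`        — `MagicFormulaZ2 → MagicFormulaT → LoopLimitZ2Blind` (XL; the residual wall; unchanged since v2/s1).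
* S5a  `stub_nolin2008_thm24`      — `Literature.Probability.Percolation.Nolin2008_thm24_fiveArm_upper` (discharge of a vendored
       published fact: Nolin 2008 Thm. 24 five-arm item; XL from RSW: landing-sequence uniqueness + five-arm extendability).
* S5b  `stub_nolin2008_prop17`     — `Literature.Probability.Percolation.Nolin2008_prop17_quasiMult` (Nolin 2008 Prop. 17,
       quasi-multiplicativity for all colour sequences; XL: arm separation for general j; the tree PROVES j = 2).
* S6'  `stub_dcmt2021_zdFiveArm`   — `Literature.Probability.Percolation.DuminilCopinManolescuTassion2021_zdFiveArm_upperBound`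
       (DCMT 2021 Prop. 6.6 at q = 1; XL: five-arm separation on bond ℤ²).
* S11  `stub_neckHookupCoarseT`    — `NeckHookupCoarseT` (L; RSW + α₄ > 1 + half-plane three-arm; typing note `S10-typing.md`).
* S12  `stub_neckHookupCoarseZ2`   — `NeckHookupCoarseZ2` (L; the ℤ² twin; α₄ > 1 on ℤ² is PROVED in the tree).
* S10' `stub_neckTomographyV4`     — `FiveArmUpperT → FiveArmUpperZ2 → NoNeckRigidity → NeckHookupCoarseT → NeckHookupCoarseZ2 →
       LoopLimitZ2Blind → LoopLimitZ2EqT` (XL: good events, D1 blob-graph structure, blind-visibility of the coarse datum,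
       identification, positivity, assembly over the landed bricks B1–B7: p144483 p144747 p144248 p144118 p144490 p150855 p151342
       p151552 p151755; S9 enters by name).
CLOSED: S9 `stub_noNeckRigidity` (tree theorem).  CONDITIONAL CLOSURES: `FiveArmUpperT` ⇐ S5a + S5b, `FiveArmUpperZ2` ⇐ S6'.
-/

noncomputable section

namespace Summit.CriticalPhenomena.CardyFormulaZ2.Cruxes.NestingRigidity.PinchResampling

open Summit.CriticalPhenomena.CardyFormulaZ2.Theses.CardyMagicRigidity
open MeasureTheory Set Literature.Probability.Percolation Literature.Probability.LatticeModels
  Literature.Probability.RandomPlanarGeometry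

/-! ## §2 The registered stubs (v4) -/

/-- STUB S1 (XL, the residual wall — child `BlindRigidity`; stated with the INLINE term, letter for letter the registration of
`Lines/fair_coin_routing.lean`, so the two lines share it): the two magic formulas force BLIND loop universality
(`= MagicFormulaZ2 → MagicFormulaT → LoopLimitZ2Blind` by `rfl`, see `stub_blindRigidity_iff`).
Why plausibly true: implied by the crux (`FairCoinRouting.blindRigidity_of_nestingRigidity`); barrier to beat:
`NestingTransformBlindness` (identities ⇒ interior LAWS needs the non-crossing / Markov structure of percolation limits). -/
theorem stub_blindRigidity :
    MagicFormulaZ2 → MagicFormulaT → Filter.Tendsto (fun δ : ℝ ↦ ⨅ (ε : ℝ) (_ : 0 < ε) (P : MeasureTheory.Measure (Literature.Probability.Percolation.BondConfig (Literature.Probability.LatticeModels.Site 2) × Literature.Probability.Percolation.SiteConfig (Literature.Probability.LatticeModels.Site 2))) (_ : P.map Prod.fst = Literature.Probability.Percolation.bondPercolation (Literature.Probability.LatticeModels.zdGraph 2) Literature.Probability.Percolation.half) (_ : P.map Prod.snd = Literature.Probability.LatticeModels.triSitePercolation Literature.Probability.Percolation.half) (_ : P {p | ¬ (∀ i : Fin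 2, (∀ u ∈ (Literature.Probability.Percolation.bondLoopConfig δ 0 p.1).F i, u.range ⊆ Metric.ball (0 : ℂ) (1 / ε) → ∃ u' ∈ (⟨fun i ↦ {u : Literature.Probability.RandomPlanarGeometry.UnbasedLoop ℂ | ∃ (v : Literature.Probability.LatticeModels.HexVertex) (γ : Literature.Probability.LatticeModels.hexGraph.Walk v v), Literature.Probability.Percolation.IsSiteInterfaceLoop p.2 γ ∧ (i = 1 ↔ 0 < Literature.Probability.Percolation.shoelace (γ.support.map Literature.Probability.LatticeModels.hexCenter)) ∧ u = Literature.Probability.RandomPlanarGeometry.UnbasedLoop.mk (Literature.Probability.RandomPlanarGeometry.BasedLoop.mk (Literature.Probability.Percolation.siteLoopCurve δ γ) (Literature.Probability.Percolation.isLoop_siteLoopCurve δ γ))}⟩ : Literature.Probability.RandomPlanarGeometry.LoopConfig ℂ).F i, Metric.hausdorffEDist u.range u'.range ≤ ENNReal.ofReal ε ∧ symmDiff {z : ℂ | u.wind z ≠ 0} {z : ℂ | u'.wind z ≠ 0} ⊆ Metric.cthickening ε (u.range ∪ u'.range)) ∧ (∀ u' ∈ (⟨fun i ↦ {u : Literature.Probability.RandomPlanarGeometry.UnbasedLoop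 ℂ | ∃ (v : Literature.Probability.LatticeModels.HexVertex) (γ : Literature.Probability.LatticeModels.hexGraph.Walk v v), Literature.Probability.Percolation.IsSiteInterfaceLoop p.2 γ ∧ (i = 1 ↔ 0 < Literature.Probability.Percolation.shoelace (γ.support.map Literature.Probability.LatticeModels.hexCenter)) ∧ u = Literature.Probability.RandomPlanarGeometry.UnbasedLoop.mk (Literature.Probability.RandomPlanarGeometry.BasedLoop.mk (Literature.Probability.Percolation.siteLoopCurve δ γ) (Literature.Probability.Percolation.isLoop_siteLoopCurve δ γ))}⟩ : Literature.Probability.RandomPlanarGeometry.LoopConfig ℂ).F i, u'.range ⊆ Metric.ball (0 : ℂ) (1 / ε) → ∃ u ∈ (Literature.Probability.Percolation.bondLoopConfig δ 0 p.1).F i, Metric.hausdorffEDist u'.range u.range ≤ ENNReal.ofReal ε ∧ symmDiff {z : ℂ | u'.wind z ≠ 0} {z : ℂ | u.wind z ≠ 0} ⊆ Metric.cthickening ε (u'.range ∪ u.range)))} < ENNReal.ofReal ε), ENNReal.ofReal ε) (nhdsWithin 0 (Set.Ioi 0)) (nhds 0) := by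
  sorry

/-- The inline statement of `stub_blindRigidity` is `MagicFormulaZ2 → MagicFormulaT → LoopLimitZ2Blind` (by `Iff.rfl`). -/
theorem stub_blindRigidity_iff :
    (MagicFormulaZ2 → MagicFormulaT → LoopLimitZ2Blind) ↔
    (MagicFormulaZ2 → MagicFormulaT → Filter.Tendsto (fun δ : ℝ ↦ ⨅ (ε : ℝ) (_ : 0 < ε) (P : MeasureTheory.Measure (Literature.Probability.Percolation.BondConfig (Literature.Probability.LatticeModels.Site 2) × Literature.Probability.Percolation.SiteConfig (Literature.Probability.LatticeModels.Site 2))) (_ : P.map Prod.fst = Literature.Probability.Percolation.bondPercolation (Literature.Probability.LatticeModels.zdGraph 2) Literature.Probability.Percolation.half) (_ : P.map Prod.snd = Literature.Probability.LatticeModels.triSitePercolation Literature.Probability.Percolation.half) (_ : P {p | ¬ (∀ i : Fin 2, (∀ u ∈ (Literature.Probability.Percolation.bondLoopConfig δ 0 p.1).F i, u.range ⊆ Metric.ball (0 : ℂ) (1 / ε) → ∃ u' ∈ (⟨fun i ↦ {u : Literature.Probability.RandomPlanarGeometry.UnbasedLoop ℂ | ∃ (v : Literature.Probability.LatticeModels.HexVertex)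 (γ : Literature.Probability.LatticeModels.hexGraph.Walk v v), Literature.Probability.Percolation.IsSiteInterfaceLoop p.2 γ ∧ (i = 1 ↔ 0 < Literature.Probability.Percolation.shoelace (γ.support.map Literature.Probability.LatticeModels.hexCenter)) ∧ u = Literature.Probability.RandomPlanarGeometry.UnbasedLoop.mk (Literature.Probability.RandomPlanarGeometry.BasedLoop.mk (Literature.Probability.Percolation.siteLoopCurve δ γ) (Literature.Probability.Percolation.isLoop_siteLoopCurve δ γ))}⟩ : Literature.Probability.RandomPlanarGeometry.LoopConfig ℂ).F i, Metric.hausdorffEDist u.range u'.range ≤ ENNReal.ofReal ε ∧ symmDiff {z : ℂ | u.wind z ≠ 0} {z : ℂ | u'.wind z ≠ 0} ⊆ Metric.cthickening ε (u.range ∪ u'.range)) ∧ (∀ u' ∈ (⟨fun i ↦ {u : Literature.Probability.RandomPlanarGeometry.UnbasedLoop ℂ | ∃ (v : Literature.Probability.LatticeModels.HexVertex) (γ : Literature.Probability.LatticeModels.hexGraph.Walk v v), Literature.Probability.Percolation.IsSiteInterfaceLoop p.2 γ ∧ (i = 1 ↔ 0 < Literature.Probability.Percolation.shoelace (γ.support.map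 Literature.Probability.LatticeModels.hexCenter)) ∧ u = Literature.Probability.RandomPlanarGeometry.UnbasedLoop.mk (Literature.Probability.RandomPlanarGeometry.BasedLoop.mk (Literature.Probability.Percolation.siteLoopCurve δ γ) (Literature.Probability.Percolation.isLoop_siteLoopCurve δ γ))}⟩ : Literature.Probability.RandomPlanarGeometry.LoopConfig ℂ).F i, u'.range ⊆ Metric.ball (0 : ℂ) (1 / ε) → ∃ u ∈ (Literature.Probability.Percolation.bondLoopConfig δ 0 p.1).F i, Metric.hausdorffEDist u'.range u.range ≤ ENNReal.ofReal ε ∧ symmDiff {z : ℂ | u'.wind z ≠ 0} {z : ℂ | u.wind z ≠ 0} ⊆ Metric.cthickening ε (u'.range ∪ u.range)))} < ENNReal.ofReal ε), ENNReal.ofReal ε) (nhdsWithin 0 (Set.Ioi 0)) (nhds 0)) :=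
  Iff.rfl

/-- STUB S5a (XL from RSW): discharge of the vendored published fact Nolin 2008 Thm. 24 five-arm item (single radius, all
non-constant colour sequences, order-free events) — `FiveArmExponentFacts.lean`.  With S5b it CLOSES `FiveArmUpperT`
(`fiveArmUpperT_of_nolin2008_facts`, p151657). -/
theorem stub_nolin2008_thm24 : Literature.Probability.Percolation.Nolin2008_thm24_fiveArm_upper := by
  sorry

/-- STUB S5b (XL from RSW): discharge of the vendored published fact Nolin 2008 Prop. 17 (quasi-multiplicativity, gluing half, at
`p = 1/2`, all colour sequences, order-free events) — `FiveArmExponentFacts.lean`; the tree proves the instance `j = 2`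
(`Nolin2008_twoArm_quasiMult_holds`). -/
theorem stub_nolin2008_prop17 : Literature.Probability.Percolation.Nolin2008_prop17_quasiMult := by
  sorry

/-- STUB S6' (XL from RSW): discharge of the vendored published fact DCMT 2021 Prop. 6.6 (five-arm upper bound, two radii, bond
`ℤ²`, cluster form `zdFiveArmClusters`) — `ZdFiveArmUpperBound.lean`.  CLOSES `FiveArmUpperZ2` (`fiveArmUpperZ2_of_DCMT2021`, p151216). -/
theorem stub_dcmt2021_zdFiveArm : Literature.Probability.Percolation.DuminilCopinManolescuTassion2021_zdFiveArm_upperBound := by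
  sorry

/-- STUB S11 (L): coarse measurability of the hook-up probability of a ball given its exterior, critical site percolation on `𝕋`
(typing note `S10-typing.md` §1–§2: Schramm–Smirnov-type discretisation at `∂B`; inputs RSW, `α₄ > 1` (RSW-only form to be filed
for site `𝕋`), half-plane three-arm `1 + α` (in tree)). -/
theorem stub_neckHookupCoarseT : NeckHookupCoarseT := by
  sorry

/-- STUB S12 (L): the `ℤ²` twin of S11 (`α₄ > 1` on bond `ℤ²` is the tree theorem `Garban2011_fourArm_multiscale_holds`). -/
theorem stub_neckHookupCoarseZ2 : NeckHookupCoarseZ2 := by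
  sorry

/-- STUB S10' (XL, rate-free, symmetry-free): **neck tomography, v4 cut** — the five-arm upper bounds (good events via the six-arm
bounds `sixArm_le_of_fiveArmUpperT` / `sixArmZ2_le_of_fiveArmUpperZ2` and the counting shell `sixArm_boxes_le_of_fiveArmUpperT`),
no-neck rigidity (free arcs, then `reparamDist_le_of_arcMatched` / `udist_mk_mk_le_of_reparamDist_arcs`), and coarse measurability
on both lattices (identification through `measureReal_inter_eq_integral_splice`) upgrade BLIND loop universality to `d_CN`
universality: blind couplings (`tendsto_blindLawEDist_of_loopLimitZ2Blind`) are improved at fixed `(η, ε, δ)` and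
`loopLimitZ2EqT_of_tendsto_blindLawEDist_of_improvement` concludes.  STILL INSIDE (typing note §4): good events G1–G5 (M), D1
blob-graph structure (L/XL), blind-visibility of `coarseBlobs` (M), identification (M), positivity (M), assembly (M; law
preservation `map_fst_comp_eq_and_map_snd_comp_eq_of_condDistrib`, error budget `routingLaw_le_pow_mul_routingLaw`, switch
parity `odd_card_partition_mul_swap_add`, small loops `isClose_of_isBlindClose_of_forall_big`). -/
theorem stub_neckTomographyV4 :
    FiveArmUpperT → FiveArmUpperZ2 → NoNeckRigidity → NeckHookupCoarseT → NeckHookupCoarseZ2 →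
      LoopLimitZ2Blind → LoopLimitZ2EqT := by
  sorry

/-! ## §3 Composition (kernel-checked, no sorry of its own) -/

/-- **The crux `NestingRigidity`, by name**, from the seven registered stubs of v4, the CLOSED stub S9 (`stub_noNeckRigidity`, tree
theorem p151077) and the landed conditional closures of `FiveArmUpperT` (p151657) / `FiveArmUpperZ2` (p151216).  The ONLY named
theorem of this file concluding the crux; its only axioms beyond the whitelist are the `sorryAx` of the stubs. -/
theorem NestingRigidity_of : NestingRigidity :=
  fun hZ hT ↦ stub_neckTomographyV4 (fiveArmUpperT_of_nolin2008_facts stub_nolin2008_thm24 stub_nolin2008_prop17)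
    (fiveArmUpperZ2_of_DCMT2021 stub_dcmt2021_zdFiveArm) stub_noNeckRigidity stub_neckHookupCoarseT stub_neckHookupCoarseZ2
    (stub_blindRigidity hZ hT)

/-- The same composition with the seven stub STATEMENTS as hypotheses (sorry-free record of the reduction; S9 by name). -/
example
    (h₁ : MagicFormulaZ2 → MagicFormulaT → LoopLimitZ2Blind)
    (h₅a : Literature.Probability.Percolation.Nolin2008_thm24_fiveArm_upper)
    (h₅b : Literature.Probability.Percolation.Nolin2008_prop17_quasiMult)
    (h₆ : Literature.Probability.Percolation.DuminilCopinManolescuTassion2021_zdFiveArm_upperBound)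
    (h₁₁ : NeckHookupCoarseT) (h₁₂ : NeckHookupCoarseZ2)
    (h₁₀ : FiveArmUpperT → FiveArmUpperZ2 → NoNeckRigidity → NeckHookupCoarseT → NeckHookupCoarseZ2 → LoopLimitZ2Blind → LoopLimitZ2EqT) :
    NestingRigidity :=
  fun hZ hT ↦ h₁₀ (fiveArmUpperT_of_nolin2008_facts h₅a h₅b) (fiveArmUpperZ2_of_DCMT2021 h₆) stub_noNeckRigidity h₁₁ h₁₂ (h₁ hZ hT)

/-! ## §4 Sanity (sorry-free) -/

/-- The v4 transfer stub is implied by the target itself (it is not stronger than the crux's own conclusion). -/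
theorem neckTomographyV4_of_target' (hX : LoopLimitZ2EqT) :
    FiveArmUpperT → FiveArmUpperZ2 → NoNeckRigidity → NeckHookupCoarseT → NeckHookupCoarseZ2 → LoopLimitZ2Blind → LoopLimitZ2EqT :=
  fun _ _ _ _ _ _ ↦ hX

/-- The v4 transfer stub is implied by the (retired) v3 transfer statement: the re-cut only adds hypotheses. -/
theorem neckTomographyV4_of_v3'
    (h : FiveArmUpperT → FiveArmUpperZ2 → NoNeckRigidity → LoopLimitZ2Blind → LoopLimitZ2EqT) :
    FiveArmUpperT → FiveArmUpperZ2 → NoNeckRigidity → NeckHookupCoarseT → NeckHookupCoarseZ2 → LoopLimitZ2Blind → LoopLimitZ2EqT :=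
  fun h₅ h₆ h₉ _ _ hB ↦ h h₅ h₆ h₉ hB

/-! ## §5 Awareness checks against the landed results this line answers to (sorry-free) -/

/-- New in v4: the landed closures and bricks the composition / S10' rest on (waves 2–3). -/
example := @loopLimitZ2EqT_of_blind_of_bigLoops_recoupling
example := @pGlue_update_ne_or_dGlue_update_ne
example := @tHookProb_eq_of_blobs_agree
example := @neckHookupCoarseT_of_approx
example := @zFourStrands_determinedBy
example := @neckHookupCoarseZ2_of_surrogate
example := @stub_noNeckRigidity
example := @fiveArmUpperT_of_nolin2008_facts
example := @fiveArmUpperZ2_of_DCMT2021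
example := @sixArm_le_of_fiveArmUpperT
example := @sixArmZ2_le_of_fiveArmUpperZ2
example := @sixArm_boxes_le_of_fiveArmUpperT
example := @reparamDist_le_of_arcMatched
example := @odd_card_partition_mul_swap_add
example := @measureReal_inter_eq_integral_splice



/-- The LOWER bound sandwiching `FiveArmUpperT` (same event, same colour sequence, `t = 1/2`). -/
example := @fiveArm_lowerBound
/-- Reimer's step on `ℤ²` in cluster form, the chain `FiveArmUpperZ2` feeds. -/
example := @real_zdFiveArmClusters_le
/-- The plumbing pinning S10 to a coupling improvement, and the small-loop brick. -/
example := @loopLimitZ2EqT_of_tendsto_blindLawEDist_of_improvement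
example := @tendsto_blindLawEDist_of_loopLimitZ2Blind
example := @isClose_of_isBlindClose_of_forall_big
example := @map_fst_comp_eq_and_map_snd_comp_eq_of_condDistrib
example := @routingLaw_le_pow_mul_routingLaw
/-- Curve-space anchors for S9 and for the gluing step of S10. -/
example := @Curve.reparamDist_eq_zero_of_monotone'
example := @Curve.exists_orientation_shift_reparam_forall_dist_lt
example := @UnbasedLoop.hausdorffDist_range_le_udist

/-- G4, configuration level (p132831): two tame loops with the same winding function that differ — the obstruction that
makes the routing transfer necessary; no stub of this line asserts that blind data determine loops. -/
example := @PositiveConeWeightDoubling.exists_tame_wind_eq_ne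
example := @PositiveConeWeightDoubling.not_tame_rigidity

/-- G4, law level (p133027): identical typed statistics at `cnLawEDist ≥ 1/2`. -/
example := @PositiveConeWeightDoubling.exists_tame_laws_windEq_le_cnLawEDist

/-- G1 (p120899): `Regular` + equal pattern counts ⇏ `d_CN`-close. -/
example := @RingCloudTomography.exists_regular_patternCount_eq_not_isClose

/-- Barrier `NestingTransformBlindness` (bites `stub_blindRigidity` only). -/
example : Literature.Barriers.CriticalPhenomena.NestingTransformBlindness :=
  Literature.Barriers.CriticalPhenomena.nestingTransformBlindness_holds

end Summit.CriticalPhenomena.CardyFormulaZ2.Cruxes.NestingRigidity.PinchResampling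

end
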